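import Summits.NavierStokesRegularity.NavierStokesRegularity.Theorems.FilamentSkeletonRssSkeletonJ1RFrameDefs
import Summits.NavierStokesRegularity.NavierStokesRegularity.Theorems.FilamentSkeletonRssSkeletonJ1RFarTools

/-!
# Route `FilamentSkeletonRss` · crux `SkeletonJ1R` (stmt-NavierStokesRegularity-23610) · stub F2 `LiaDefectL` — two SUB-BRICKS about the switched
# normal defect `swDefect` of a reference skeleton in a datum-sliced frame (director dss_161 (2)(α); helpers only, the S-bend self-induction
# asymptotics that are F2's heart are NOT here)

Vocabulary: `…SkeletonJ1RFrameDefs` (lead `ns-fsr-lead-23610`; `bsField`, `switchWeight`, `switchedField`, `swDefect`, `SlicedModel`,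
`SlicedReference`).  Line of record `streamline_kantorovich_R`, skeleton v2 (ff0eba9f7176; F2 = `stub_liaDefectL : LiaDefectL`).
* §1 (α1) NO DEFECT OFF THE SWITCHED REGION.  The normal part of a vector parallel to the tangent vanishes (`sub_proj_smul_self`); hence at every
  point of the reference `x_j` where the switch weight is `0` the switched field is the sliced model, which is tangent to the reference with the arm
  speed (`SlicedModel.apply_ref`), so `swDefect … x j τ = 0` (`swDefect_ref_eq_zero_of_switchWeight_eq_zero`); in particular for
  `2ℓ² ≤ ‖x_j τ‖²`, `ℓ = Rb√(Γ log Γ)` (`swDefect_ref_eq_zero_of_sq_le`).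
* §2 (α2) THE PARTNER PART OF THE REGULARISED BIOT–SAVART FIELD along any curve family with global chord–arc constant `c` and separation `d`:
  `‖bsField Γ γ X (X_j τ) − (self term of j)‖ ≤ N·(ΓG/(4π))·16/(c d)` UNIFORMLY in `τ` (`norm_bsField_sub_self_le`, from the landed
  `…SkeletonJ1RFarTools.norm_biotSavart_le_of_separated`); for a datum-sliced reference (tilt `≤ Rb/8 ≤ 1/8` ⇒ chord–arc `½`, separation
  `(ρ/2)√Γ`) this is `≤ (16·N·G/(π ρ))·√Γ` = `O(√Γ/ρ)` (`norm_partnerField_le_of_slicedReference`) — the crude size of the mutual field from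
  which the F2 prover subtracts the partners' straight-datum ambient field.
HONEST FRAMING: MODEL rung, ∃-side helper lemmas about a HYPOTHETICAL filament-type blow-up skeleton; F2 and the crux 23610 stay OPEN; nothing here
bears on Navier–Stokes regularity, which is NOT proved. [folklore]
-/

-- `dupNamespace` off: the module name repeats `NavierStokesRegularity` by the tree's `Summits/<S>/<S>/Theorems` layout (same as every sibling file).
set_option linter.dupNamespace false

noncomputable section

namespace Summit.NavierStokesRegularity.NavierStokesRegularity.Theorems.SkeletonJ1RDefectTools

open MeasureTheory Filter Topology
open Literature.Analysis.FluidPDE Literature.Analysis.FluidPDE.Tao2016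
open Summit.NavierStokesRegularity.NavierStokesRegularity.Theorems.SkeletonJ1RFrame
open Summit.NavierStokesRegularity.NavierStokesRegularity.Theorems.SkeletonJ1RSlipTools
open scoped RealInnerProductSpace InnerProductSpace BigOperators

/-! ## §1 (α1) No defect off the switched region -/

/-- The normal part of a multiple of a nonzero vector vanishes: `a•T − (⟪a•T, T⟫/‖T‖²)•T = 0`. [folklore] -/
theorem sub_proj_smul_self (a : ℝ) {T : EuclideanSpace ℝ (Fin 3)} (hT : T ≠ 0) :
    a • T - (⟪a • T, T⟫ / ‖T‖ ^ 2) • T = 0 := by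
  have hT2 : ‖T‖ ^ 2 ≠ 0 := pow_ne_zero 2 (norm_ne_zero_iff.2 hT)
  rw [real_inner_smul_left, real_inner_self_eq_norm_sq, mul_div_assoc, div_self hT2, mul_one, sub_self]

/-- At full switch-on, where the switch weight vanishes the switched field of ANY skeleton `Z` is the outer model. [folklore] -/
theorem switchedField_one_eq_model_of_switchWeight_eq_zero {N : ℕ} {Γ Rb : ℝ} (γ : Fin N → ℝ) (α : ℝ)
    (M : EuclideanSpace ℝ (Fin 3) → EuclideanSpace ℝ (Fin 3)) (Z : Fin N → ℝ → EuclideanSpace ℝ (Fin 3)) {y : EuclideanSpace ℝ (Fin 3)}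
    (hw : switchWeight (Rb * Real.sqrt (Γ * Real.log Γ)) 1 y = 0) : switchedField Γ Rb γ α M 1 Z y = M y := by
  simp [switchedField, hw]

/-- **(α1) No defect off the switched region.**  For a unit-speed reference `x` and a datum-sliced model `M` about it (`0 ≤ ρ√Γ`), the
switched normal defect of the reference vanishes at every point where the switch weight is `0` (there the field is the model, tangent to `x` with
the arm speed `(7/4)τ`). [folklore] -/
theorem swDefect_ref_eq_zero_of_switchWeight_eq_zero {N : ℕ} {Γ ρ lam Rb : ℝ} {γ : Fin N → ℝ} {α : ℝ} {t : Fin N → EuclideanSpace ℝ (Fin 3)}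
    {x : Fin N → ℝ → EuclideanSpace ℝ (Fin 3)} {M : EuclideanSpace ℝ (Fin 3) → EuclideanSpace ℝ (Fin 3)}
    (hM : SlicedModel Γ ρ lam t x M) (hρΓ : 0 ≤ ρ * Real.sqrt Γ) (hunit : ∀ j τ, ‖deriv (x j) τ‖ = 1) (j : Fin N) (τ : ℝ)
    (hw : switchWeight (Rb * Real.sqrt (Γ * Real.log Γ)) 1 (x j τ) = 0) : swDefect Γ Rb γ α M x j τ = 0 := by
  have hT : deriv (x j) τ ≠ 0 := by
    intro h; have := hunit j τ; rw [h, norm_zero] at this; exact zero_ne_one this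
  unfold swDefect
  rw [switchedField_one_eq_model_of_switchWeight_eq_zero γ α M x hw, SlicedModel.apply_ref hM hρΓ j τ]
  exact sub_proj_smul_self _ hT

/-- **(α1′) explicit region.**  With `ℓ = Rb√(Γ log Γ) ≠ 0`: the defect of the reference vanishes wherever `2ℓ² ≤ ‖x_j τ‖²` (outside the collar
the switch weight at `s = 1` is `0`, `switchWeight_eq_zero_of_le_sq`). [folklore] -/
theorem swDefect_ref_eq_zero_of_sq_le {N : ℕ} {Γ ρ lam Rb : ℝ} {γ : Fin N → ℝ} {α : ℝ} {t : Fin N → EuclideanSpace ℝ (Fin 3)}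
    {x : Fin N → ℝ → EuclideanSpace ℝ (Fin 3)} {M : EuclideanSpace ℝ (Fin 3) → EuclideanSpace ℝ (Fin 3)}
    (hM : SlicedModel Γ ρ lam t x M) (hρΓ : 0 ≤ ρ * Real.sqrt Γ) (hunit : ∀ j τ, ‖deriv (x j) τ‖ = 1)
    (hℓ : Rb * Real.sqrt (Γ * Real.log Γ) ≠ 0) (j : Fin N) (τ : ℝ)
    (hfar : 2 * (Rb * Real.sqrt (Γ * Real.log Γ)) ^ 2 ≤ ‖x j τ‖ ^ 2) : swDefect Γ Rb γ α M x j τ = 0 :=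
  swDefect_ref_eq_zero_of_switchWeight_eq_zero hM hρΓ hunit j τ
    (switchWeight_eq_zero_of_le_sq hℓ (by linarith))

/-! ## §2 (α2) The partner part of the regularised Biot–Savart field, uniformly along the arm -/

/-- **(α2) Partner-field bound.**  For `C¹` curves `X_k` with `‖X_k′‖ ≤ 1`, global chord–arc constant `c > 0`, every partner at distance `≥ d > 0`
from the point `X_j τ`, weights `|γ_k| ≤ G` and `0 ≤ Γ`: the regularised Biot–Savart field of the family at `X_j τ` minus its self term has norm
`≤ N·(ΓG/(4π))·16/(c d)`, uniformly in `τ`. [folklore] -/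
theorem norm_bsField_sub_self_le {N : ℕ} {X : Fin N → ℝ → EuclideanSpace ℝ (Fin 3)} (hX : ∀ k, ContDiff ℝ 1 (X k))
    (hd1 : ∀ k u, ‖deriv (X k) u‖ ≤ 1) {c d Γ G : ℝ} {γ : Fin N → ℝ} (hc : 0 < c)
    (hchord : ∀ k u s, c * |u - s| ≤ ‖X k u - X k s‖) (hd : 0 < d) (j : Fin N) (τ : ℝ)
    (hsep : ∀ k, k ≠ j → ∀ σ, d ≤ ‖X j τ - X k σ‖) (hγ : ∀ k, |γ k| ≤ G) (hΓ : 0 ≤ Γ) :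
    ‖bsField Γ γ X (X j τ) - (Γ * γ j / (4 * Real.pi)) • ∫ σ : ℝ, ((‖X j τ - X j σ‖ ^ 2 +
        Real.exp (-(1+Real.eulerMascheroniConstant-Real.log 2)) * (1:ℝ)) ^ (3 / 2 : ℝ))⁻¹ • cross (deriv (X j) σ) (X j τ - X j σ)‖ ≤
      N * (Γ * G / (4 * Real.pi) * (16 / (c * d))) := by
  -- the core constant `e² = e^{−(1+γ_E−log 2)}·1 > 0` (cf. `SkeletonJ1RFrame.coreConst_pos` of `…SkeletonJ1RLiaReference`)
  have hc0 : 0 < Real.exp (-(1+Real.eulerMascheroniConstant-Real.log 2)) * (1:ℝ) := by rw [mul_one]; exact Real.exp_pos _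
  set e : ℝ := Real.sqrt (Real.exp (-(1+Real.eulerMascheroniConstant-Real.log 2)) * (1:ℝ)) with he_def
  have he2 : Real.exp (-(1+Real.eulerMascheroniConstant-Real.log 2)) * (1:ℝ) = e ^ 2 := by rw [he_def, Real.sq_sqrt hc0.le]
  have he : e ≠ 0 := by rw [he_def]; exact (Real.sqrt_pos.2 hc0).ne'
  -- name the strand fields
  set F : Fin N → EuclideanSpace ℝ (Fin 3) := fun k => ∫ σ : ℝ, ((‖X j τ - X k σ‖ ^ 2 + e ^ 2) ^ (3 / 2 : ℝ))⁻¹ •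
    cross (deriv (X k) σ) (X j τ - X k σ) with hF
  have hfield : bsField Γ γ X (X j τ) = ∑ k, (Γ * γ k / (4 * Real.pi)) • F k := by
    unfold bsField; simp only [he2, hF]
  have hself : (Γ * γ j / (4 * Real.pi)) • ∫ σ : ℝ, ((‖X j τ - X j σ‖ ^ 2 +
      Real.exp (-(1+Real.eulerMascheroniConstant-Real.log 2)) * (1:ℝ)) ^ (3 / 2 : ℝ))⁻¹ • cross (deriv (X j) σ) (X j τ - X j σ) =
      (Γ * γ j / (4 * Real.pi)) • F j := by simp only [he2, hF]
  rw [hfield, hself, ← Finset.sum_erase_eq_sub (Finset.mem_univ j)]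
  -- termwise bound on the partners
  have hG : 0 ≤ G := le_trans (abs_nonneg _) (hγ j)
  have hterm : ∀ k ∈ Finset.univ.erase j, ‖(Γ * γ k / (4 * Real.pi)) • F k‖ ≤ Γ * G / (4 * Real.pi) * (16 / (c * d)) := by
    intro k hk
    have hkj : k ≠ j := Finset.ne_of_mem_erase hk
    rw [norm_smul, Real.norm_eq_abs]
    have hcoef : |Γ * γ k / (4 * Real.pi)| ≤ Γ * G / (4 * Real.pi) := by
      rw [abs_div, abs_mul, abs_of_nonneg hΓ, abs_of_pos (by positivity : (0:ℝ) < 4 * Real.pi)]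
      gcongr; exact hγ k
    have hFk : ‖F k‖ ≤ 16 / (c * d) :=
      norm_biotSavart_le_of_separated (hX k) (hd1 k) hc (hchord k) hd he (y := X j τ) (hsep k hkj)
    exact mul_le_mul hcoef hFk (norm_nonneg _) (by positivity)
  refine (norm_sum_le _ _).trans ((Finset.sum_le_sum hterm).trans ?_)
  rw [Finset.sum_const, nsmul_eq_mul]
  have hcard : ((Finset.univ.erase j).card : ℝ) ≤ N := by
    rw [Finset.card_erase_of_mem (Finset.mem_univ j), Finset.card_univ, Fintype.card_fin]
    exact_mod_cast Nat.sub_le N 1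
  exact mul_le_mul_of_nonneg_right hcard (by positivity)

/-- Tangent oscillation of a datum-sliced reference: `‖x_j′ u − x_j′ v‖ ≤ Rb/4` (tilt `≤ Rb/8` against `t_j`). [folklore] -/
theorem slicedReference_osc {N : ℕ} {Γ ρ Rb : ℝ} {p t : Fin N → EuclideanSpace ℝ (Fin 3)} {s₀ : Fin N → ℝ}
    {x : Fin N → ℝ → EuclideanSpace ℝ (Fin 3)} (hx : SlicedReference Γ ρ Rb p t s₀ x) (j : Fin N) (u v : ℝ) :
    ‖deriv (x j) u - deriv (x j) v‖ ≤ Rb / 4 := by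
  calc ‖deriv (x j) u - deriv (x j) v‖ = ‖(deriv (x j) u - t j) - (deriv (x j) v - t j)‖ := by congr 1; abel
    _ ≤ ‖deriv (x j) u - t j‖ + ‖deriv (x j) v - t j‖ := norm_sub_le _ _
    _ ≤ Rb / 8 + Rb / 8 := add_le_add (hx.2.1 j u) (hx.2.1 j v)
    _ = Rb / 4 := by ring

/-- **(α2′) The partner field along a datum-sliced reference is `O(√Γ/ρ)`, uniformly in `τ`.**  For a `SlicedReference` with `0 ≤ Rb ≤ 1`, `0 < ρ`,
`0 < Γ`, weights `|γ_k| ≤ G`: `‖bsField Γ γ x (x_j τ) − (self term of j)‖ ≤ N·(ΓG/(4π))·16/((1/2)·((ρ/2)√Γ))` `= (16 N G/(π ρ))·√Γ`. [folklore] -/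
theorem norm_partnerField_le_of_slicedReference {N : ℕ} {Γ ρ Rb G : ℝ} {γ : Fin N → ℝ} {p t : Fin N → EuclideanSpace ℝ (Fin 3)}
    {s₀ : Fin N → ℝ} {x : Fin N → ℝ → EuclideanSpace ℝ (Fin 3)} (hx : SlicedReference Γ ρ Rb p t s₀ x) (hRb : 0 ≤ Rb) (hRb1 : Rb ≤ 1)
    (hρ : 0 < ρ) (hΓ : 0 < Γ) (hγ : ∀ k, |γ k| ≤ G) (j : Fin N) (τ : ℝ) :
    ‖bsField Γ γ x (x j τ) - (Γ * γ j / (4 * Real.pi)) • ∫ σ : ℝ, ((‖x j τ - x j σ‖ ^ 2 +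
        Real.exp (-(1+Real.eulerMascheroniConstant-Real.log 2)) * (1:ℝ)) ^ (3 / 2 : ℝ))⁻¹ • cross (deriv (x j) σ) (x j τ - x j σ)‖ ≤
      N * (Γ * G / (4 * Real.pi) * (16 / (1 / 2 * (ρ / 2 * Real.sqrt Γ)))) := by
  have hcd : ∀ k, ContDiff ℝ 1 (x k) := fun k => (hx.1 k).1.of_le (by norm_num)
  have hun : ∀ k s, ‖deriv (x k) s‖ = 1 := fun k => (hx.1 k).2.1
  have hchord : ∀ k u s, 1 / 2 * |u - s| ≤ ‖x k u - x k s‖ := by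
    intro k u s
    have h := chord_arc_of_osc (hcd k) (hun k) (slicedReference_osc hx k) u s
    have hRb2 : Rb ^ 2 ≤ 1 := by nlinarith
    have hc : (1:ℝ) / 2 ≤ 1 - (Rb / 4) ^ 2 / 2 := by nlinarith
    exact le_trans (mul_le_mul_of_nonneg_right hc (abs_nonneg _)) h
  have hsΓ : 0 < Real.sqrt Γ := Real.sqrt_pos.2 hΓ
  exact norm_bsField_sub_self_le hcd (fun k u => (hun k u).le) (by norm_num) hchord (by positivity) j τ
    (fun k hkj σ => hx.2.2.2 j k (Ne.symm hkj) τ σ) hγ hΓ.le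

end Summit.NavierStokesRegularity.NavierStokesRegularity.Theorems.SkeletonJ1RDefectTools

end
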